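import Mathlib
import HarnessLib
import HarnessLib.Audit
import Summits.AnomalousDissipation.Statement
import Literature.Analysis.FluidPDE.LerayHopf
import Literature.Analysis.FluidPDE.ZerothLaw
import Literature.Analysis.FluidPDE.DoeringFoias
import Literature.Analysis.FluidPDE.StokesTorus
import Literature.Analysis.FluidPDE.StokesTorusProofs
import Literature.Analysis.FluidPDE.StatisticalSolution
import Literature.Analysis.FluidPDE.LongTimeAverageNonneg
import Literature.Analysis.FunctionSpaces.TorusTrigPoly

/-!
Route: SteadyCoherentFraction

CLOSED (refuted) 2026-09-03T00:54:44Z by gate — reason: refuted:stmt-AnomalousDissipation-28522 (RootsPlanar) by Summit.AnomalousDissipation.AnomalousDissipation.Theorems.CrossedShearRoot.not_rootsPlanar — note: repair grace of 72.0 h (deadline 2026-09-03T00:53:09Z) expired without a repair — closed by the gate. The file is kept as the record of this route; refuted decls are indexed as negative knowledge (`ledger negatives`).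

# Route SteadyCoherentFraction — steady non-planar Kolmogorov states exist and keep a
three-dimensional fraction; planarity of finite-enstrophy steady Euler-drift roots makes them loud

Decomposition node of cell decomp-ad (lens-4 «minimal counterexample / extremal reduction»,
generation 19): CHILD ROUTE of CoherentFraction refining
:28074 (InvariantExtremeClimatesPlanar) / :33307 (BoundedQuietPlanarity, ClassTrim-shared ⇒ no
family-wide trim) in the cell TREE — the STEADY TRIM of that
cone at the pinned force f_K = sin(4πx₁)e₀ on T³; its deciding theorem concludes the summit itself
(it bypasses, not proves, the parent residual, so no gate
`refines` edge is declared), and it shares RatioUpgrade and, after the birth split,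
FiniteModeRootsPlanar with the parent by signature. The parent's rigidity door is applied only to
the witnesses its existence side delivers, and those are declared STEADY;
so the door is trimmed to STEADY Leray–Hopf states u(t) ≡ u₀ (relative equilibria), whose long-time
climates are Dirac masses. It suffices to show
X = X1 ∧ X2 ∧ X3 ∧ X4 ∧ X5 ∧ X6: X2 (RootsPlanar, the Liouville core): every finite-enstrophy steady
weak root (v, m) of Euler + (m·∇) + f_K is planar
(invariant under some horizontal rational translation family); X3 (SteadyTameReduction,
theorem-grade support): X2 implies the tame half of the steady
door by Rellich compactness; X4 (RoughSteadyQuietPlanarity): the K41 face of the steady door; X5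
(BoundedNonPlanarSteadyStates, fixed-viscosity
existence): bounded NON-PLANAR steady Leray–Hopf states of NS_ν_j(f_K) exist along some ν_j → 0; X6
(SteadyCoherentFractionPersists, declared residual):
if so, some such family keeps defect ≥ φ₀ · energy; X1 (RatioUpgrade): the rate-per-energy zeroth
law implies the audited one.
Lean: `RatioUpgrade ∧ RootsPlanar ∧ SteadyTameReduction ∧ RoughSteadyQuietPlanarity ∧
BoundedNonPlanarSteadyStates ∧ SteadyCoherentFractionPersists`

## Assembly
Pure logic (theorem closes in glue.lean, every binder consumed; the cell kernel file proves the same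
text as `closes` and the door form
`closes_via_door`): SteadyCoherentFractionPersists applied to BoundedNonPlanarSteadyStates gives E₀,
φ₀, ν_j and steady Leray–Hopf states u₀ʲ with
energy ≤ E₀, 0 < defect, φ₀·energy ≤ defect. RoughSteadyQuietPlanarity gives a level R and, at
(φ₀/2, E₀), a θ₂; SteadyTameReduction applied to RootsPlanar at
level R and (φ₀/2, E₀) gives θ₁; with θ₀ := min θ₁ θ₂, a quiet u₀ʲ (dissipation ≤ θ₀·energy) would
have defect ≤ (φ₀/2)·energy whether ‖∇u₀ʲ‖² ≤ R or > R,
forcing energy ≤ 0 and defect ≤ 0, contradiction; hence θ₀·energy < dissipation for every j, and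
isSmooth/isDivFree/hasZeroMean of stokesMode (0,2,0) e₀
(k ≠ 0, k·e₀ = 0) give the hypothesis of RatioUpgrade with the constant trajectories t ↦ u₀ʲ, which
concludes.

Rationale: WHY THIS LINE. A steady state realises its own long-time means and IS its own stationary statistical
solution (δ_{u₀}), so the inviscid rigidity the lineage needs
(parent: TameEulerClimatesPlanar over all tame stationary climates, refined to extreme
T²_h-invariant climates InvariantExtremeClimatesPlanar) collapses,
on the witnesses the route actually produces, to a Liouville statement about INDIVIDUAL H¹ roots of
the steady forced Euler–drift system — no Krein–Milman,
no invariant hulls, no Foias–Prodi generalized limits; the parent residual's untouchable enemy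
(ergodic invariant climates charging no steady root) is not
in this cone at all, and on paper InvariantExtremeClimatesPlanar ⟹ RootsPlanarBeyondFiniteModes (the
T²-orbit climate of an infinite-type root is an
extreme invariant climate). Imported areas: compactness/selection for vanishing-viscosity limits of
STEADY Navier–Stokes (arXiv:2601.08647, 2-D, o(ν) forces;
here 3-D, O(1) single-mode force, compactness half only), Liouville/rigidity theorems for steady
Euler (arXiv:1703.07293, doi:10.1002/cpa.21670,
doi:10.1007/s00039-014-0281-8 — 2-D or Beltrami, unforced), finite-mode rigidity of Kolmogorov-type
flows (arXiv:2110.08039), equivariant steady bifurcation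
for the existence side (doi:10.1016/0021-8928(61)90079-2, doi:10.1016/0021-8928(65)90025-5,
doi:10.1016/0022-1236(71)90030-9, doi:10.1103/RevModPhys.79.519),
and — as the named ENEMY, not a tool — Nash–Moser/KAM construction of quasi-periodic/steady forced
Euler states (arXiv:2003.14313, arXiv:2207.11008).
What prior routes do not do: CoherentStates / SteadyWeakLimit / SteadyMirrorGate posit LOUD steady
families; CoherentFraction and ClassTrim carry the
rigidity as a statement about all bounded quiet Leray–Hopf trajectories or all tame stationary
climates; here the rigidity is about single steady roots and
its open residual is measurably smaller (census T-LARGEDRIFT-LS v1: the formal non-planar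
large-drift root family is unobstructed at first layer, so the
residual is the honest first question of the whole lineage and closes negatively on one explicit
root).

RANKED CRUXES. #2 SteadyCoherentFractionPersists (crux) — (declared RESIDUAL OR-sibling, rank 2) if
bounded non-planar STEADY global Leray–Hopf states of NS_ν_j(f_K) exist along some ν_j → 0 (the text
of BoundedNonPlanarSteadyStates), then along some ν_j → 0 there are such steady states whose
planar-symmetry defect is at least φ₀ times their energy, φ₀ > 0 uniform in j. BOOKING: R°-strength
OR-sibling in class exactly as the parent item CoherentFractionPersists (critic label E6 inherited
verbatim: with BoundedNonPlanarSteadyStates the cone entails a bounded LOUD steady Leray–Hopf family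
at the pinned f_K = SteadyZerothLaw-at-f_K in Leray–Hopf currency); residual-axis credit none;
instrument T-DRIFT-SW2 (continuation of the standing-wave steady branch in ν) prices it. [deps:
BoundedNonPlanarSteadyStates] [difficulty: open-problem] (why it might fail: every bounded steady
non-planar family may flatten as ν → 0: near-onset standing-wave branches have defect ∝ amplitude²,
possibly ∝ ν, and large-amplitude steady exact coherent states (lower branches) become
streamwise-independent, i.e. planar, as Re → ∞.) [doi:10.1103/PhysRevLett.98.204501,
doi:10.1146/annurev-fluid-120710-101228, doi:10.1088/0169-5983/48/6/061425, doi:10.1017/jfm.2017.97]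
#3 RootsPlanar (crux) — (the Liouville core of the steady door; = the parent item
FiniteModeRootsPlanar with the finite-mode hypothesis deleted; to be SPLIT at birth into
FiniteModeRootsPlanar ∧ RootsPlanarBeyondFiniteModes by Fourier type) for every drift m ∈ ℝ³, every
level R and every v in the energy space H (L², div-free, mean zero) with ‖∇v‖² ≤ R: if (v, m) is a
steady weak root of Euler + (m·∇) + f_K in cylindrical form (for every cylindrical test functional
Φ: ⟨f_K, ∇Φ(v)⟩ + ⟨v, (m·∇)∇Φ(v)⟩ + inertial pairing = 0), then the planar-symmetry defect of v
(infimum over horizontal lattice directions p of ½∫₀¹‖v(·+s p̂) − v‖²) vanishes. Kernel-WEAKER than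
the parent's TameEulerClimatesPlanar (Dirac climates). UNDECIDED: census T-LARGEDRIFT-LS v1
(crit-certified) finds no first-layer obstruction to formal non-planar large-drift roots; KAM
closure open. [difficulty: open-problem] (why it might fail: a non-planar finite-enstrophy steady
root may exist: the formal large-drift root series around 2-D–3-C Euler cells pass every
energy/Casimir solvability condition through order μ⁻⁶ (census T-LARGEDRIFT-LS v1); a Nash–Moser
closure of Baldi–Montalto type would refute the crux by one explicit root.) [arXiv:2601.08647,
arXiv:1703.07293, doi:10.1002/cpa.21670, arXiv:2110.08039, arXiv:2003.14313, arXiv:2207.11008]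
#4 BoundedNonPlanarSteadyStates (crux) — there are E₀ > 0 and viscosities 0 < ν_j ≤ 1, ν_j → 0, and
for every j a STEADY global Leray–Hopf solution u(t) ≡ u₀ of NS_ν_j(sin(4πx₁)e₀) (any mean momentum:
horizontally travelling waves are steady at a shifted mean) with meanEnergy ≤ E₀ and positive
planar-symmetry defect. Kernel-STRONGER than the parent crux BoundedNonPlanarCoherentStates (a
steady state is 1-periodic). ATTACKABLE NOW, THEOREM-GRADE (L): the parent's plan verbatim —
dissipation-induced odd REAL crossing of the oblique standing-wave pair of the planar drift family
at cross-flow p₁₁(ν) → p** ≈ 0.18 in Fix(κ,σ′,τ₁) (parent's local spectra g14),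
Krasnosel'skii–Rabinowitz ⇒ a steady non-planar branch at every small ν with energy ≈ 0.13; caveats
(α) transversality/isolation certified numerically only, (β) standing-wave isotropy needed (a pure
oblique travelling wave is planar), (γ) classical ⇒ Leray–Hopf via the tree. [difficulty: L] (why it
might fail: the parity argument needs the unstable count of the drift family in Fix(κ,σ′,τ₁) to pass
from 0 (large cross-flow) to exactly 1 (p → 0⁺) through the oblique (1,±1) block at EVERY small ν; a
competing planar block crossing first, or an even crossing, voids it.)
[doi:10.1016/0021-8928(61)90079-2, doi:10.1016/0021-8928(65)90025-5,
doi:10.1016/0022-1236(71)90030-9, doi:10.1007/978-0-85729-112-7, doi:10.1103/RevModPhys.79.519]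
#5 RoughSteadyQuietPlanarity (crux) — (the K41 face of the steady door; = the parent aside
RoughQuietPlanarity restricted to steady states, kernel-WEAKER) there is an enstrophy level R such
that for every φ > 0 and energy bound M some θ₀ > 0 makes every STEADY global Leray–Hopf state u₀ of
NS_ν(f_K), 0 < ν ≤ 1, with ‖∇u₀‖² > R, energy ≤ M and dissipation ≤ θ₀ · energy have planar-symmetry
defect ≤ φ · energy. UNDECIDED (world W_rough: quiet steady states with ν^{-1/2} internal layers);
any inviscid-limit attack lands on sub-H¹ steady Euler roots, which are h-principle flexible
(arXiv:1401.4301 Thm 1), so the Leray–Hopf energy structure must be used. [difficulty: open-problem]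
(why it might fail: quiet but rough steady states (νZ ~ √ν → 0, Z ~ ν^{-1/2}, internal shear layers)
with an O(1) three-dimensional component would refute it; nothing known excludes them, and weak
stationary Euler limits below H¹ are flexible (convex integration).) [arXiv:1401.4301,
AlexakisDoering2006, doi:10.1017/jfm.2012.524, arXiv:2601.08647]
#9 SteadyTameReduction (support) — (THEOREM-GRADE TARGET (cell card §5) · FIRST PROVER TARGET · not
proved; replaces the parent supports TameClimateReduction / InvariantHullReduction /
FiniteModeClimatesPlanar in this cone) RootsPlanar implies the tame half of the steady door at every
enstrophy level R: for every φ, M there is θ₀ > 0 such that steady Leray–Hopf states with ‖∇u₀‖² ≤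
R, energy ≤ M, dissipation ≤ θ₀·energy have defect ≤ φ·energy. Proof sketch (contrapositive): a
violating sequence has ν_n‖∇u_n‖² ≤ E_n/n; energies cannot vanish (test the steady weak form against
a fixed trigonometric Ψ with ⟨f_K,Ψ⟩ = 1); ν_n → 0 (else ‖∇u_n‖ → 0 contradicts f_K ≠ 0); the
viscous term is ≤ (ν_n·ν_n‖∇u_n‖²)^{1/2}‖∇Ψ‖ → 0; Rellich gives a strong L² limit m + v with ‖∇v‖² ≤
R which is a root; the defect is an infimum of L²-continuous functionals hence upper semicontinuous,
so defect(v) ≥ limsup defect(u_n) ≥ φ·lim E_n > 0 — a non-planar finite-enstrophy root. [difficulty: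
M] [arXiv:2601.08647, doi:10.1017/CBO9780511546754]
#9 RatioUpgrade (support) — (verbatim the SymmetricOrLoud / ClassTrim / CoherentFraction item
RatioUpgrade; dedup by signature) the rate-per-energy form of the zeroth law at some smooth
divergence-free mean-zero steady force implies AnomalousDissipation (Doering–Foias bookkeeping).
[difficulty: M] [DoeringFoias2002, CheskidovDoeringPetrov2006]
#9 SteadyQuietPlanarity (support) — (ASIDE — the trimmed door in one piece, never staffed; kind
aside in route.json) the parent door BoundedQuietPlanarity restricted to steady Leray–Hopf states:
for every φ, M there is θ₀ > 0 such that every steady global Leray–Hopf state of NS_ν(f_K), 0 < ν ≤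
1, with energy ≤ M and dissipation ≤ θ₀·energy has defect ≤ φ·energy. Kernel: weaker than
BoundedQuietPlanarity; exact cut SteadyQuietPlanarity ⟺ TameSteadyQuietPlanarity ∧
RoughSteadyQuietPlanarity. [difficulty: open-problem] [AlexakisDoering2006,
doi:10.1017/jfm.2012.524]
#9 TameSteadyQuietPlanarity (support) — (ASIDE — exactness witness of the tame/rough cut, never
staffed; kind aside in route.json) the tame half of the steady door at every enstrophy level R (the
parent aside TameQuietPlanarity restricted to steady states; kernel-weaker). [difficulty:
open-problem] [AlexakisDoering2006, arXiv:2601.08647]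
#9 BoundedThreeDSteadyStates (support) — (ASIDE — typed mechanism statement, the conclusion of
SteadyCoherentFractionPersists; never staffed; kind aside in route.json) there are E₀, φ₀ > 0,
viscosities ν_j → 0 in (0,1] and steady global Leray–Hopf states of NS_ν_j(f_K) with energy ≤ E₀,
positive defect and defect ≥ φ₀·energy. Kernel: implies the parent aside
BoundedThreeDCoherentStates. [difficulty: open-problem] [doi:10.1146/annurev-fluid-120710-101228,
doi:10.1088/0169-5983/48/6/061425]

TWO-LAYER PLAN. RootsPlanar ⇐ (FiniteModeRootsPlanar: the parent item, roots a.e. equal to a Fourier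
truncation are planar — Kishimoto–Yoneda finite-mode engine, hand
certificate S₈ of the cell) → (RootsPlanarBeyondFiniteModes: infinite-type finite-enstrophy roots
are planar — the typed residual of this cone) → RootsPlanar;
the glue is excluded middle on «finite type» (kernel rootsPlanar_iff) and the split is filed right
after birth. BoundedNonPlanarSteadyStates ⇐
(DriftSpectralParity) → (OddCrossingSteadyBranch) → BoundedNonPlanarSteadyStates exactly as in the
parent's two-layer plan, now with STEADY output (the
crossing eigenvalue is real). Nothing else is filed now.

KILL CRITERIA. ONE explicit non-planar finite-enstrophy steady root of Euler + drift + f_K (e.g. a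
Nash–Moser closure of the census's formal large-drift series) refutes
RootsPlanar / RootsPlanarBeyondFiniteModes and closes the route (close --reason
refuted:RootsPlanar); it is banked as the barrier «flexible steady forced
Euler–drift states» and retires the Liouville door of the whole lineage (the parent's
TameEulerClimatesPlanar and InvariantExtremeClimatesPlanar fall with it
by the kernel/paper implications; the door statements themselves are not refuted by a root). A
bounded quiet ROUGH non-planar steady family refutes
RoughSteadyQuietPlanarity (pivot: tame-only door, witnesses must then be certified tame). Refutation
of SteadyCoherentFractionPersists (every bounded steady
non-planar family flattens) closes this OR-branch and returns the lineage to the parent's periodic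
witnesses / ClassTrim's trajectory residual. E6 label
(mandatory): the cone entails a bounded loud steady Leray–Hopf family at f_K. A proof of the zeroth
law elsewhere moots the route.

NOT DECOMPOSED YET. The Fourier-type split of RootsPlanar (filed immediately after birth, see
Two-layer plan); the spectral/bifurcation lemmas under BoundedNonPlanarSteadyStates;
the Rellich/weak-form lemmas under SteadyTameReduction (Leray–Hopf weak form of a constant
trajectory, lower semicontinuity of the spectral seminorm, upper
semicontinuity of the defect); constants (E₀, p** ≈ 0.18) are not optimised; zero-momentum variants
and the parent's periodic satellites stay with the parent.

CHEAPEST FALSIFIER. Census T-LARGEDRIFT-LS v2 (records-only continuation of the certified v1 run,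
exact rational arithmetic, hub seconds): the GROWTH LAW of the formal
large-drift root coefficients ‖v_n‖ (n ≤ 12–14) around the Taylor–Green cell and h = aψ̄ — geometric
growth ⇒ an analytic-in-1/μ non-planar root family is
plausible and RootsPlanar becomes a refutation target (Nash–Moser, Baldi–Montalto class); factorial
growth ⇒ divergent series, KAM/Cantor family at best, the
crux survives with «Gevrey obstruction» as its idea slot. Already run (v1, crit-certified): no
obstruction through μ⁻⁶ / μ⁻⁵; Galerkin solvability alternates
with truncation parity.

NUMBERS. Drift family: amplitude A(p,ν) = 1/(4π√(p²+16π²ν²)), energy p² + A²/2 ≈ 0.13 at p ≈ 0.18,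
dissipation ν/(2(p²+16π²ν²)); oblique real crossing p₁₁(ν) =
0.162, 0.174, 0.178, 0.179 at ν = 4·10⁻³ … 5·10⁻⁴ (parent g14). Census T-LARGEDRIFT-LS v1:
solvability defects S₁…S₆ = 0 exactly on the TG cell (k₁ = 0
data pure gradients through μ⁻⁶), S₁…S₅ = 0 for cells with vertical flow; Galerkin truncations |k|∞
≤ K alternate solvable/unsolvable with the parity of K.

DEFINITION REQUESTS. None: all statements are over
Literature.Analysis.FluidPDE.Torus.IsGlobalLerayHopf, meanEnergy, meanDissipation, longTimeAvgSup,
toTorus, stokesMode,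
CylindricalTest, inertialPairing and Literature.Analysis.FunctionSpaces.Torus.energySpace /
eGradNormSq / fderiv / fourierTruncate.

Novelty: Searches (2026-08-30): lit search --hybrid "steady Euler uniform drift Kolmogorov forcing Liouville
planar" (8 book hits, none on point); lit vsearch "<RootsPlanar in prose>" -k 8 (Majda–Bertozzi
p.433, Marchioro–Pulvirenti; none on point); lit search "Choffrut Székelyhidi stationary Euler"
(held paper:arxiv-1401.4301); lit search "selection steady Euler vanishing viscosity" (held
paper:arxiv-2601.08647); lit galaxy search "Liouville theorem for steady Euler|steady Euler flows
are shear flows|rigidity of steady Euler" --star all (0 rows); lit galaxy search "steady Euler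
flow|Kolmogorov flow" --star pdf (12 rows, none on forced 3-D rigidity); lean search
'RootsPlanar|steady.*Euler.*planar' (tree: only the parent items 27870/27427); ledger negatives
--problem AnomalousDissipation (no entry on steady Euler roots).
Nearest prior art found: arXiv:2601.08647 Thm 1.1 (2-D selection principle for vanishing-viscosity
limits of steady Navier–Stokes with o(ν) forces: constant vorticity / Couette–Poiseuille);
arXiv:1703.07293 and doi:10.1002/cpa.21670 (Hamel–Nadirashvili: 2-D steady Euler flows without
stagnation are shear flows); arXiv:1401.4301 Thm 1 (Choffrut–Székelyhidi: L^∞ stationary Euler flows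
are h-principle flexible, d ≥ 2 — the reason the crux is typed at finite enstrophy); in the tree,
the parent items TameEulerClimatesPlanar 27427 / InvariantExtremeClimatesPlanar 28074 (statistical)
and FiniteModeRootsPlanar 27870 (finite type only).
Delta: the lineage's inviscid rigidity is  [refs: 10.1002/cpa.21670, 2601.08647, 1703.07293, 1401.4301, paper:arxiv-1401.4301, paper:arxiv-2601.08647, doi:10.1002/cpa.21670]

Barriers (technique_class: compactness-liouville, steady-rigidity, bifurcation): - technique_class: compactness-liouville, steady-rigidity, bifurcation
- Uncatalogued barrier files (not gate-registered names, placed all the same):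
Literature/Barriers/AnomalousDissipation/QuietRootFloorBarrier.lean (QuietRootFloorBarrier_holds,
not_uniformFloor_of_nondegenerateRoot) — outside: RootsPlanar / RoughSteadyQuietPlanarity / the door
are relative-planarity statements, not dissipation floors; its mechanism (a nondegenerate truncated
root carries an O(ν) quiet steady branch) is this route's named ENEMY one level up (a non-planar H¹
root kills RootsPlanar), placed as the kill criterion, not evaded; the birth stub
stub_roughSteadyFloor is restricted to ROUGH steady states, where the barrier's tame branches do not
witness. Literature/Barriers/AnomalousDissipation/GravestModeLaminarAttractor.lean
(Marchioro1986_globalAttraction) — does not quantify over this route: the force sits on the second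
shell |k| = 2 (mode (0,2,0)), not the gravest mode.
- Literature.Barriers.AnomalousDissipation.AlexakisDoering2006_energyDissipationBound: used, not
fought — planar bounded families are quiet, which is why the existence crux demands a POSITIVE
defect.
- Literature.Barriers.AnomalousDissipation.BardosTitiWiedemann2012_thm5: outside —
viscosity-selected shear flows are planar steady states with zero defect; they satisfy every
rigidity item here (ShearFlowViscositySelection family likewise: selection among planar states).
- Literature.Barriers.AnomalousDissipation.BrenierDeLellisSze

History (route lifecycle, newest last):
- 2026-08-30T22:24:10Z · rev 4: informal re-worded for RootsPlanarBeyondFiniteModes (planner-decomp-ad-lens-4-g21-0)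
- 2026-08-31T00:53:09Z · BROKEN — RootsPlanar (stmt-AnomalousDissipation-28522, crux) refuted by Summit.AnomalousDissipation.AnomalousDissipation.Theorems.CrossedShearRoot.not_rootsPlanar (prover-decomp-ad-census-1-g9-0)
- 2026-08-31T00:59:34Z · BROKEN — RootsPlanarBeyondFiniteModes (stmt-AnomalousDissipation-28530, crux) refuted by Summit.AnomalousDissipation.AnomalousDissipation.Theorems.CrossedShearRoot.not_rootsPlanarBeyondFiniteModes (prover-decomp-ad-census-1-g9-0)
- 2026-09-03T00:54:44Z · CLOSED refuted — refuted:stmt-AnomalousDissipation-28522 (RootsPlanar) by Summit.AnomalousDissipation.AnomalousDissipation.Theorems.CrossedShearRoot.not_rootsPlanar (grace expired, auto-close) (gate)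

sub-problem: AnomalousDissipation · status: closed(refuted) · opened planner-decomp-ad-lens-4-g19-0 2026-08-30T21:20:25Z · rev 4 · ledger route-AnomalousDissipation-SteadyCoherentFraction
GENERATED by the gate from the ledger (D-0016/17). Provers cite these decls: `theorem foo : Summit.AnomalousDissipation.AnomalousDissipation.Theses.SteadyCoherentFraction.<Decl> := …` in Summits/AnomalousDissipation/AnomalousDissipation/Theorems/<Name>.lean.
-/

namespace Summit.AnomalousDissipation.AnomalousDissipation.Theses.SteadyCoherentFraction

open scoped BigOperators Topology Manifold Classical MeasureTheory ProbabilityTheory Matrix InnerProductSpace ComplexConjugate ContinuousMap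
open Filter Set Function TopologicalSpace MeasureTheory

attribute [summit_statement] _root_.AnomalousDissipation

open Literature.Turb

/-- item stmt-AnomalousDissipation-28521 · crux · rank 2 · closed · moot by None · by planner
why it might fail: every bounded steady non-planar family may flatten as ν → 0: near-onset standing-wave branches have defect ∝ amplitude², possibly ∝ ν, and large-amplitude steady exact coherent states (lower branches) become streamwise-independent, i.e. planar, as Re → ∞.
sources: doi:10.1103/PhysRevLett.98.204501, doi:10.1146/annurev-fluid-120710-101228, doi:10.1088/0169-5983/48/6/061425, doi:10.1017/jfm.2017.97
[crux] (declared RESIDUAL OR-sibling, rank 2) if bounded non-planar STEADY global Leray–Hopf states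
of NS_ν_j(f_K) exist along some ν_j → 0 (the text of BoundedNonPlanarSteadyStates), then along some
ν_j → 0 there are such steady states whose planar-symmetry defect is at least φ₀ times their energy,
φ₀ > 0 uniform in j. BOOKING: R°-strength OR-sibling in class exactly as the parent item
CoherentFractionPersists (critic label E6 inherited verbatim: with BoundedNonPlanarSteadyStates the
cone entails a bounded LOUD steady Leray–Hopf family at the pinned f_K = SteadyZerothLaw-at-f_K in
Leray–Hopf currency); residual-axis credit none; instrument T-DRIFT-SW2 (continuation of the
standing-wave steady branch in ν) prices it. [deps: BoundedNonPlanarSteadyStates] [difficulty: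
open-problem] -/
@[route_item "route-AnomalousDissipation-SteadyCoherentFraction"]
def SteadyCoherentFractionPersists : Prop :=
  (∃ E₀ : ℝ, 0 < E₀ ∧ ∃ (ν : ℕ → ℝ), (∀ j, 0 < ν j) ∧ (∀ j, ν j ≤ 1) ∧ Filter.Tendsto ν Filter.atTop (nhds 0) ∧ ∀ j, ∃ (u₀ : UnitAddTorus (Fin 3) → EuclideanSpace ℝ (Fin 3)), Literature.Analysis.FluidPDE.Torus.IsGlobalLerayHopf (ν j) (fun _ => ⇑(Literature.Analysis.FluidPDE.Torus.stokesMode (![0, 2, 0] : Fin 3 → ℤ) (EuclideanSpace.single (0 : Fin 3) (1 : ℝ)) false)) u₀ (fun _ => u₀) ∧ Literature.Analysis.FluidPDE.meanEnergy (fun _ => u₀) ≤ E₀ ∧ 0 < Literature.Analysis.FluidPDE.longTimeAvgSup (fun _ => ⨅ p : {p : ℤ × ℤ // p ≠ 0}, (1 / 2 : ℝ) * ∫ s in (0 : ℝ)..1, ∫ x, ‖u₀ (x + Literature.Analysis.FluidPDE.toTorus (fun i => s * (![((p.1.1 : ℤ) : ℝ), 0, ((p.1.2 : ℤ) : ℝ)]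 : Fin 3 → ℝ) i)) - u₀ x‖ ^ 2)) → (∃ (E₀ φ₀ : ℝ), 0 < E₀ ∧ 0 < φ₀ ∧ ∃ (ν : ℕ → ℝ), (∀ j, 0 < ν j) ∧ (∀ j, ν j ≤ 1) ∧ Filter.Tendsto ν Filter.atTop (nhds 0) ∧ ∀ j, ∃ (u₀ : UnitAddTorus (Fin 3) → EuclideanSpace ℝ (Fin 3)), Literature.Analysis.FluidPDE.Torus.IsGlobalLerayHopf (ν j) (fun _ => ⇑(Literature.Analysis.FluidPDE.Torus.stokesMode (![0, 2, 0] : Fin 3 → ℤ) (EuclideanSpace.single (0 : Fin 3) (1 : ℝ)) false)) u₀ (fun _ => u₀) ∧ Literature.Analysis.FluidPDE.meanEnergy (fun _ => u₀) ≤ E₀ ∧ 0 < Literature.Analysis.FluidPDE.longTimeAvgSup (fun _ => ⨅ p : {p : ℤ × ℤ // p ≠ 0}, (1 / 2 : ℝ) * ∫ s in (0 : ℝ)..1, ∫ x, ‖u₀ (x + Literature.Analysis.FluidPDE.toTorus (fun i => s * (![((p.1.1 : ℤ) : ℝ), 0, ((p.1.2 : ℤ) : ℝ)] : Fin 3 →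 ℝ) i)) - u₀ x‖ ^ 2) ∧ φ₀ * Literature.Analysis.FluidPDE.meanEnergy (fun _ => u₀) ≤ Literature.Analysis.FluidPDE.longTimeAvgSup (fun _ => ⨅ p : {p : ℤ × ℤ // p ≠ 0}, (1 / 2 : ℝ) * ∫ s in (0 : ℝ)..1, ∫ x, ‖u₀ (x + Literature.Analysis.FluidPDE.toTorus (fun i => s * (![((p.1.1 : ℤ) : ℝ), 0, ((p.1.2 : ℤ) : ℝ)] : Fin 3 → ℝ) i)) - u₀ x‖ ^ 2))

/-- item stmt-AnomalousDissipation-28522 · crux · rank 3 · closed · refuted by Summit.AnomalousDissipation.AnomalousDissipation.Theorems.CrossedShearRoot.not_rootsPlanar (prover) · by planner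
why it might fail: a non-planar finite-enstrophy steady root may exist: energy/Casimir/orbit conditions pass through μ⁻⁶ (E28); the hyperbolic-point conditions (E28a) kill only the plain cellular series; layered, even-tuned (b*, c*) or channel ansätze remain; one Nash–Moser root from them refutes the crux.
sources: arXiv:2601.08647, arXiv:1703.07293, doi:10.1002/cpa.21670, arXiv:2110.08039, arXiv:2003.14313, arXiv:2207.11008
[crux] (the Liouville core of the steady door; = the parent item FiniteModeRootsPlanar with the
finite-mode hypothesis deleted; to be SPLIT at birth into FiniteModeRootsPlanar ∧
RootsPlanarBeyondFiniteModes by Fourier type) for every drift m ∈ ℝ³, every level R and every v in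
the energy space H (L², div-free, mean zero) with ‖∇v‖² ≤ R: if (v, m) is a steady weak root of
Euler + (m·∇) + f_K in cylindrical form (for every cylindrical test functional Φ: ⟨f_K, ∇Φ(v)⟩ + ⟨v,
(m·∇)∇Φ(v)⟩ + inertial pairing = 0), then the planar-symmetry defect of v (infimum over horizontal
lattice directions p of ½∫₀¹‖v(·+s p̂) − v‖²) vanishes. Kernel-WEAKER than the parent's
TameEulerClimatesPlanar (Dirac climates). UNDECIDED: census T-LARGEDRIFT-LS v1 (crit-certified)
finds no first-layer obstruction to formal non-planar large-drift roots; KAM closure open.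
[difficulty: open-problem] -/
@[route_item "route-AnomalousDissipation-SteadyCoherentFraction"]
def RootsPlanar : Prop :=
  ∀ (m : EuclideanSpace ℝ (Fin 3)) (R : ℝ) (v : ↥(Literature.Analysis.FunctionSpaces.Torus.energySpace (Fin 3))), Literature.Analysis.FunctionSpaces.Torus.eGradNormSq ((v : MeasureTheory.Lp (EuclideanSpace ℝ (Fin 3)) 2 (MeasureTheory.volume : MeasureTheory.Measure (UnitAddTorus (Fin 3)))) : UnitAddTorus (Fin 3) → EuclideanSpace ℝ (Fin 3)) ≤ ENNReal.ofReal R → (∀ Φ : Literature.Analysis.FluidPDE.Torus.CylindricalTest (Fin 3), ((∫ x, ⟪⇑(Literature.Analysis.FluidPDE.Torus.stokesMode (![0, 2, 0] : Fin 3 → ℤ) (EuclideanSpace.single (0 : Fin 3) (1 : ℝ)) false) x, Φ.grad v x⟫_ℝ) + (∫ x, ⟪((v : MeasureTheory.Lp (EuclideanSpace ℝ (Fin 3)) 2 (MeasureTheory.volume : MeasureTheory.Measure (UnitAddTorus (Fin 3)))) : UnitAddTorus (Fin 3) → EuclideanSpace ℝ (Fin 3)) x, Literature.Analysis.FunctionSpaces.Torus.fderiv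 (Φ.grad v) x m⟫_ℝ) + Literature.Analysis.FluidPDE.Torus.inertialPairing (v : MeasureTheory.Lp (EuclideanSpace ℝ (Fin 3)) 2 (MeasureTheory.volume : MeasureTheory.Measure (UnitAddTorus (Fin 3)))) (Φ.grad v)) = 0) → (⨅ p : {p : ℤ × ℤ // p ≠ 0}, (1 / 2 : ℝ) * ∫ s in (0 : ℝ)..1, ∫ x, ‖((v : MeasureTheory.Lp (EuclideanSpace ℝ (Fin 3)) 2 (MeasureTheory.volume : MeasureTheory.Measure (UnitAddTorus (Fin 3)))) : UnitAddTorus (Fin 3) → EuclideanSpace ℝ (Fin 3)) (x + Literature.Analysis.FluidPDE.toTorus (fun i => s * (![((p.1.1 : ℤ) : ℝ), 0, ((p.1.2 : ℤ) : ℝ)] : Fin 3 → ℝ) i)) - ((v : MeasureTheory.Lp (EuclideanSpace ℝ (Fin 3)) 2 (MeasureTheory.volume : MeasureTheory.Measure (UnitAddTorus (Fin 3)))) : UnitAddTorus (Fin 3) → EuclideanSpace ℝ (Fin 3)) x‖ ^ 2) = 0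

-- parent: RootsPlanar · child (gen 1)
/--     item stmt-AnomalousDissipation-27870 · crux · rank 301 · open
    parent: RootsPlanar · by planner
    why it might fail: a non-planar root supported on finitely many Fourier modes may exist at some drift m: the Kishimoto–Yoneda engine is proved for unforced finite-mode 3-D flows and the forced+drift algebra is only hand-certified up to |k|∞ ≤ 1 (S₈); a larger truncation could host one.
    sources: arXiv:2110.08039, arXiv:2601.08647
[support · rank 9 · BC5/T3 RUNG of TameEulerClimatesPlanar 27427 / BoundedQuietPlanarity 33307 ·
lens-4 g17 node SpectralHullCut] FINITE-MODE ROOTS ARE PLANAR: for every constant drift m, enstrophy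
level R and every div-free mean-zero L² field v on T³ with finitely many Fourier modes (v =
fourierTruncate N v a.e.), ‖∇v‖² ≤ R, that is a steady weak root of Euler + (m·∇) + f_K (f_K =
sin(4πx₁)e₀) against every cylindrical test, the planarity defect inf_{p∈ℤ²∖0} ½∫₀¹‖v(·+s(p₁,0,p₂))
− v‖² ds vanishes. = TEP restricted to Dirac climates at finite-mode fields (kernel weakerF).
Engine: Kishimoto–Yoneda finite-Fourier-support rigidity (convex hull of the support + two-mode
interaction lemma) adapted to the forced pair ±(0,2,0) and the diagonal drift term; skeleton
bc/FiniteModeRootsPlanar_birth.lean (stub_hullRigidity, stub_defectOfInvariant). Kernel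
run/shared/lean/pub/decomp-ad/decomp-ad-lens-4/g17/SpectralHullCut.lean -/
@[route_item "route-AnomalousDissipation-SteadyCoherentFraction"]
def FiniteModeRootsPlanar : Prop :=
  ∀ (m : EuclideanSpace ℝ (Fin 3)) (R : ℝ) (v : ↥(Literature.Analysis.FunctionSpaces.Torus.energySpace (Fin 3))), (∃ N : ℕ, ((v : MeasureTheory.Lp (EuclideanSpace ℝ (Fin 3)) 2 (MeasureTheory.volume : MeasureTheory.Measure (UnitAddTorus (Fin 3)))) : UnitAddTorus (Fin 3) → EuclideanSpace ℝ (Fin 3)) =ᵐ[MeasureTheory.volume] Literature.Analysis.FunctionSpaces.Torus.fourierTruncate N ((v : MeasureTheory.Lp (EuclideanSpace ℝ (Fin 3)) 2 (MeasureTheory.volume : MeasureTheory.Measure (UnitAddTorus (Fin 3)))) : UnitAddTorus (Fin 3) → EuclideanSpace ℝ (Fin 3))) → Literature.Analysis.FunctionSpaces.Torus.eGradNormSq ((v : MeasureTheory.Lp (EuclideanSpace ℝ (Fin 3)) 2 (MeasureTheory.volume : MeasureTheory.Measure (UnitAddTorus (Fin 3)))) : UnitAddTorus (Fin 3) → EuclideanSpace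 ℝ (Fin 3)) ≤ ENNReal.ofReal R → (∀ Φ : Literature.Analysis.FluidPDE.Torus.CylindricalTest (Fin 3), ((∫ x, ⟪⇑(Literature.Analysis.FluidPDE.Torus.stokesMode (![0, 2, 0] : Fin 3 → ℤ) (EuclideanSpace.single (0 : Fin 3) (1 : ℝ)) false) x, Φ.grad v x⟫_ℝ) + (∫ x, ⟪((v : MeasureTheory.Lp (EuclideanSpace ℝ (Fin 3)) 2 (MeasureTheory.volume : MeasureTheory.Measure (UnitAddTorus (Fin 3)))) : UnitAddTorus (Fin 3) → EuclideanSpace ℝ (Fin 3)) x, Literature.Analysis.FunctionSpaces.Torus.fderiv (Φ.grad v) x m⟫_ℝ) + Literature.Analysis.FluidPDE.Torus.inertialPairing (v : MeasureTheory.Lp (EuclideanSpace ℝ (Fin 3)) 2 (MeasureTheory.volume : MeasureTheory.Measure (UnitAddTorus (Fin 3)))) (Φ.grad v)) = 0) → (⨅ p : {p : ℤ × ℤ // p ≠ 0}, (1 / 2 : ℝ) * ∫ s in (0 : ℝ)..1, ∫ x, ‖((v : MeasureTheory.Lp (EuclideanSpace ℝ (Fin 3)) 2 (MeasureTheory.volume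 : MeasureTheory.Measure (UnitAddTorus (Fin 3)))) : UnitAddTorus (Fin 3) → EuclideanSpace ℝ (Fin 3)) (x + Literature.Analysis.FluidPDE.toTorus (fun i => s * (![((p.1.1 : ℤ) : ℝ), 0, ((p.1.2 : ℤ) : ℝ)] : Fin 3 → ℝ) i)) - ((v : MeasureTheory.Lp (EuclideanSpace ℝ (Fin 3)) 2 (MeasureTheory.volume : MeasureTheory.Measure (UnitAddTorus (Fin 3)))) : UnitAddTorus (Fin 3) → EuclideanSpace ℝ (Fin 3)) x‖ ^ 2) = 0

-- parent: RootsPlanar · child (gen 1)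
/--     item stmt-AnomalousDissipation-28530 · crux · rank 302 · closed · refuted by Summit.AnomalousDissipation.AnomalousDissipation.Theorems.CrossedShearRoot.not_rootsPlanarBeyondFiniteModes (prover)
    parent: RootsPlanar · by planner
    why it might fail: an infinite-type non-planar root may still exist: the hyperbolic-point conditions (E28a) kill only the PLAIN cellular large-drift series; layered (x₁-dependent), even-tuned (b*, c*) or channel (m_h ≠ 0) ansätze are open beyond first order; a Nash–Moser closure from one refutes it by one root.
    sources: arXiv:2003.14313, arXiv:2207.11008, arXiv:1703.07293, doi:10.1002/cpa.21670, doi:10.1137/S0036139992236785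
[crux · RESIDUAL OF RECORD of the steady cone (cell word; NOT a tribunal residual) · IDEA-NEEDED ·
INSTRUMENTED (T-LARGEDRIFT-LS v1 E28 + v2 E28a): plain cellular continuation at large vertical drift
EXCLUDED AT FIRST LIVE ORDER by the hyperbolic-point conditions — square TG shell S₆¹(x_s) =
a³(1−ε²)/84 at μ⁻⁵ (rigid under all tested kernel freedom); odd 3-C profiles bψ̄: κ₃(x_s) = −b/6 at
μ⁻³, THEOREM-GRADE in the smooth class (rung: aside LargeDriftCellExclusion); live enemies W_layer,
W_even (TG b* = √(3135/301) at O(1); cell E c* = 1156/363 at O(μ⁻¹); next order open), W_channel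
(m_h ≠ 0 = KAM proper) · idea slot «hyperbolic stagnation points of the horizontal mean flow vs eddy
momentum flux — exact point identities» · implied on paper by Q♭ 28074, in kernel by TEP 27427 ·
closes NEGATIVELY on ONE explicit non-planar infinite-type root · rung: aside
LargeDriftCellExclusion (lens-4 g20 TLD-v2 / census TLD-v2-CERT / crit tld2chk E28a)] every
INFINITE-TYPE (not a.e. equal to any Fourier truncation) finite-enstrophy steady weak root (v, m) of
Euler + (m·∇) + f_K is planar (planar-symmetry defect = inf over horizontal lattice directions p of
½∫₀¹‖v(·+s p̂) − v‖² vanishes). [deps: no -/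
@[route_item "route-AnomalousDissipation-SteadyCoherentFraction"]
def RootsPlanarBeyondFiniteModes : Prop :=
  ∀ (m : EuclideanSpace ℝ (Fin 3)) (R : ℝ) (v : ↥(Literature.Analysis.FunctionSpaces.Torus.energySpace (Fin 3))), ¬ (∃ N : ℕ, ((v : MeasureTheory.Lp (EuclideanSpace ℝ (Fin 3)) 2 (MeasureTheory.volume : MeasureTheory.Measure (UnitAddTorus (Fin 3)))) : UnitAddTorus (Fin 3) → EuclideanSpace ℝ (Fin 3)) =ᵐ[MeasureTheory.volume] Literature.Analysis.FunctionSpaces.Torus.fourierTruncate N ((v : MeasureTheory.Lp (EuclideanSpace ℝ (Fin 3)) 2 (MeasureTheory.volume : MeasureTheory.Measure (UnitAddTorus (Fin 3)))) : UnitAddTorus (Fin 3) → EuclideanSpace ℝ (Fin 3))) → Literature.Analysis.FunctionSpaces.Torus.eGradNormSq ((v : MeasureTheory.Lp (EuclideanSpace ℝ (Fin 3)) 2 (MeasureTheory.volume : MeasureTheory.Measure (UnitAddTorus (Fin 3)))) : UnitAddTorus (Fin 3) → EuclideanSpace ℝ (Fin 3)) ≤ ENNReal.ofReal R → (∀ Φ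 : Literature.Analysis.FluidPDE.Torus.CylindricalTest (Fin 3), ((∫ x, ⟪⇑(Literature.Analysis.FluidPDE.Torus.stokesMode (![0, 2, 0] : Fin 3 → ℤ) (EuclideanSpace.single (0 : Fin 3) (1 : ℝ)) false) x, Φ.grad v x⟫_ℝ) + (∫ x, ⟪((v : MeasureTheory.Lp (EuclideanSpace ℝ (Fin 3)) 2 (MeasureTheory.volume : MeasureTheory.Measure (UnitAddTorus (Fin 3)))) : UnitAddTorus (Fin 3) → EuclideanSpace ℝ (Fin 3)) x, Literature.Analysis.FunctionSpaces.Torus.fderiv (Φ.grad v) x m⟫_ℝ) + Literature.Analysis.FluidPDE.Torus.inertialPairing (v : MeasureTheory.Lp (EuclideanSpace ℝ (Fin 3)) 2 (MeasureTheory.volume : MeasureTheory.Measure (UnitAddTorus (Fin 3)))) (Φ.grad v)) = 0) → (⨅ p : {p : ℤ × ℤ // p ≠ 0}, (1 / 2 : ℝ) * ∫ s in (0 : ℝ)..1, ∫ x, ‖((v : MeasureTheory.Lp (EuclideanSpace ℝ (Fin 3)) 2 (MeasureTheory.volume : MeasureTheory.Measure (UnitAddTorus (Fin 3)))) : UnitAddTorus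 (Fin 3) → EuclideanSpace ℝ (Fin 3)) (x + Literature.Analysis.FluidPDE.toTorus (fun i => s * (![((p.1.1 : ℤ) : ℝ), 0, ((p.1.2 : ℤ) : ℝ)] : Fin 3 → ℝ) i)) - ((v : MeasureTheory.Lp (EuclideanSpace ℝ (Fin 3)) 2 (MeasureTheory.volume : MeasureTheory.Measure (UnitAddTorus (Fin 3)))) : UnitAddTorus (Fin 3) → EuclideanSpace ℝ (Fin 3)) x‖ ^ 2) = 0

-- parent: RootsPlanar · glue (gen 1)
/--     item stmt-AnomalousDissipation-28531 · support · rank 303 · closed · proved by Summit.AnomalousDissipation.AnomalousDissipation.Theorems.RootsCutGlue.rootsCutGlue_holds (prover)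
    parent: RootsPlanar · GLUE: children ⟹ parent · by planner
excluded middle on «a.e. equal to a Fourier truncation» (cell kernel rootsPlanar_iff /
rootsCutGlue_holds, lens-4 g19; birth skeleton bc_birth/RootsPlanar_birth.lean proves RootsPlanar_of
from the two children) -/
@[route_item "route-AnomalousDissipation-SteadyCoherentFraction"]
def RootsCutGlue : Prop :=
  FiniteModeRootsPlanar → RootsPlanarBeyondFiniteModes → RootsPlanar

-- `RootsCutGlue` holds: proved by `Summit.AnomalousDissipation.AnomalousDissipation.Theorems.RootsCutGlue.rootsCutGlue_holds` (its module imports this route file, so no `_holds` link can be stated here).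

/-- item stmt-AnomalousDissipation-28523 · crux · rank 4 · closed · moot by None · by planner
why it might fail: the parity argument needs the unstable count of the drift family in Fix(κ,σ′,τ₁) to pass from 0 (large cross-flow) to exactly 1 (p → 0⁺) through the oblique (1,±1) block at EVERY small ν; a competing planar block crossing first, or an even crossing, voids it.
sources: doi:10.1016/0021-8928(61)90079-2, doi:10.1016/0021-8928(65)90025-5, doi:10.1016/0022-1236(71)90030-9, doi:10.1007/978-0-85729-112-7, doi:10.1103/RevModPhys.79.519
[crux] there are E₀ > 0 and viscosities 0 < ν_j ≤ 1, ν_j → 0, and for every j a STEADY global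
Leray–Hopf solution u(t) ≡ u₀ of NS_ν_j(sin(4πx₁)e₀) (any mean momentum: horizontally travelling
waves are steady at a shifted mean) with meanEnergy ≤ E₀ and positive planar-symmetry defect.
Kernel-STRONGER than the parent crux BoundedNonPlanarCoherentStates (a steady state is 1-periodic).
ATTACKABLE NOW, THEOREM-GRADE (L): the parent's plan verbatim — dissipation-induced odd REAL
crossing of the oblique standing-wave pair of the planar drift family at cross-flow p₁₁(ν) → p** ≈
0.18 in Fix(κ,σ′,τ₁) (parent's local spectra g14), Krasnosel'skii–Rabinowitz ⇒ a steady non-planar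
branch at every small ν with energy ≈ 0.13; caveats (α) transversality/isolation certified
numerically only, (β) standing-wave isotropy needed (a pure oblique travelling wave is planar), (γ)
classical ⇒ Leray–Hopf via the tree. [difficulty: L] -/
@[route_item "route-AnomalousDissipation-SteadyCoherentFraction"]
def BoundedNonPlanarSteadyStates : Prop :=
  ∃ E₀ : ℝ, 0 < E₀ ∧ ∃ (ν : ℕ → ℝ), (∀ j, 0 < ν j) ∧ (∀ j, ν j ≤ 1) ∧ Filter.Tendsto ν Filter.atTop (nhds 0) ∧ ∀ j, ∃ (u₀ : UnitAddTorus (Fin 3) → EuclideanSpace ℝ (Fin 3)), Literature.Analysis.FluidPDE.Torus.IsGlobalLerayHopf (ν j) (fun _ => ⇑(Literature.Analysis.FluidPDE.Torus.stokesMode (![0, 2, 0] : Fin 3 → ℤ) (EuclideanSpace.single (0 : Fin 3) (1 : ℝ)) false)) u₀ (fun _ => u₀) ∧ Literature.Analysis.FluidPDE.meanEnergy (fun _ => u₀) ≤ E₀ ∧ 0 < Literature.Analysis.FluidPDE.longTimeAvgSup (fun _ => ⨅ p : {p : ℤ × ℤ // p ≠ 0}, (1 / 2 : ℝ) * ∫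 s in (0 : ℝ)..1, ∫ x, ‖u₀ (x + Literature.Analysis.FluidPDE.toTorus (fun i => s * (![((p.1.1 : ℤ) : ℝ), 0, ((p.1.2 : ℤ) : ℝ)] : Fin 3 → ℝ) i)) - u₀ x‖ ^ 2)

/-- item stmt-AnomalousDissipation-28524 · crux · rank 5 · closed · moot by None · by planner
why it might fail: quiet but rough steady states (νZ ~ √ν → 0, Z ~ ν^{-1/2}, internal shear layers) with an O(1) three-dimensional component would refute it; nothing known excludes them, and weak stationary Euler limits below H¹ are flexible (convex integration).
sources: arXiv:1401.4301, AlexakisDoering2006, doi:10.1017/jfm.2012.524, arXiv:2601.08647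
[crux] (the K41 face of the steady door; = the parent aside RoughQuietPlanarity restricted to steady
states, kernel-WEAKER) there is an enstrophy level R such that for every φ > 0 and energy bound M
some θ₀ > 0 makes every STEADY global Leray–Hopf state u₀ of NS_ν(f_K), 0 < ν ≤ 1, with ‖∇u₀‖² > R,
energy ≤ M and dissipation ≤ θ₀ · energy have planar-symmetry defect ≤ φ · energy. UNDECIDED (world
W_rough: quiet steady states with ν^{-1/2} internal layers); any inviscid-limit attack lands on
sub-H¹ steady Euler roots, which are h-principle flexible (arXiv:1401.4301 Thm 1), so the Leray–Hopf
energy structure must be used. [difficulty: open-problem] -/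
@[route_item "route-AnomalousDissipation-SteadyCoherentFraction"]
def RoughSteadyQuietPlanarity : Prop :=
  ∃ R : ℝ, ∀ φ : ℝ, 0 < φ → ∀ M : ℝ, 0 < M → ∃ θ₀ : ℝ, 0 < θ₀ ∧ ∀ ν : ℝ, 0 < ν → ν ≤ 1 → ∀ (u₀ : UnitAddTorus (Fin 3) → EuclideanSpace ℝ (Fin 3)), Literature.Analysis.FluidPDE.Torus.IsGlobalLerayHopf ν (fun _ => ⇑(Literature.Analysis.FluidPDE.Torus.stokesMode (![0, 2, 0] : Fin 3 → ℤ) (EuclideanSpace.single (0 : Fin 3) (1 : ℝ)) false)) u₀ (fun _ => u₀) → ENNReal.ofReal R < Literature.Analysis.FunctionSpaces.Torus.eGradNormSq u₀ → Literature.Analysis.FluidPDE.meanEnergy (fun _ => u₀) ≤ M → Literature.Analysis.FluidPDE.meanDissipation ν (fun _ => u₀) ≤ θ₀ * Literature.Analysis.FluidPDE.meanEnergy (fun _ => u₀) → Literature.Analysis.FluidPDE.longTimeAvgSup (fun _ => ⨅ p : {p : ℤ × ℤ // p ≠ 0}, (1 / 2 : ℝ) * ∫ s in (0 : ℝ)..1,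 ∫ x, ‖u₀ (x + Literature.Analysis.FluidPDE.toTorus (fun i => s * (![((p.1.1 : ℤ) : ℝ), 0, ((p.1.2 : ℤ) : ℝ)] : Fin 3 → ℝ) i)) - u₀ x‖ ^ 2) ≤ φ * Literature.Analysis.FluidPDE.meanEnergy (fun _ => u₀)

/-- item stmt-AnomalousDissipation-23805 · support · rank 9 · open · by planner
sources: DoeringFoias2002, CheskidovDoeringPetrov2006
[crux] the rate-per-energy form of the zeroth law (some smooth divergence-free mean-zero steady
force, some θ > 0, ν_j → 0, global Leray–Hopf solutions with θ·meanEnergy(u_j) <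
meanDissipation(ν_j,u_j)) implies AnomalousDissipation: the energy bound comes from meanDissipation
≤ ‖f‖₂·√meanEnergy, the floor from the Doering–Foias amplitude bound (meanEnergy ≥ c(f) > 0 for ν ≤
1, f ≠ 0 being forced by the strict ratio inequality). [difficulty: M] -/
@[route_item "route-AnomalousDissipation-SteadyCoherentFraction"]
def RatioUpgrade : Prop :=
  (∃ f : UnitAddTorus (Fin 3) → EuclideanSpace ℝ (Fin 3), Literature.Analysis.FunctionSpaces.Torus.IsSmooth f ∧ Literature.Analysis.FunctionSpaces.Torus.IsDivFree f ∧ Literature.Analysis.FunctionSpaces.Torus.HasZeroMean f ∧ ∃ θ : ℝ, 0 < θ ∧ ∃ (ν : ℕ → ℝ) (u₀ : ℕ → UnitAddTorus (Fin 3) → EuclideanSpace ℝ (Fin 3)) (u : ℕ → ℝ → UnitAddTorus (Fin 3) → EuclideanSpace ℝ (Fin 3)), (∀ j, 0 < ν j) ∧ Filter.Tendsto ν Filter.atTop (nhds 0) ∧ (∀ j, Literature.Analysis.FluidPDE.Torus.IsGlobalLerayHopf (ν j) (fun _ => f) (u₀ j) (u j)) ∧ ∀ j, θ * Literature.Analysis.FluidPDE.meanEnergy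 (u j) < Literature.Analysis.FluidPDE.meanDissipation (ν j) (u j)) → _root_.AnomalousDissipation

/-- item stmt-AnomalousDissipation-26790 · aside · rank 9 · closed · moot by None · by planner
sources: AlexakisDoering2006, arXiv:2003.14313, arXiv:2207.11008, doi:10.1137/S0036139992236785, arXiv:2601.08647
[support] (ASIDE — kind aside, rank 9, NOT in `closes` (BC6), never counted as progress; crit-1 g7
ruling (β) STATUS 2026-08-30T22:10:41Z) THEOREM-GRADE M–L RUNG under R_∞
`RootsPlanarBeyondFiniteModes` (28530) / `RootsPlanar` (28522): LARGE-DRIFT EXCLUSION OF THE 2-D–3-C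
TAYLOR–GREEN CELL IN THE SMOOTH CLASS — for every a > 0, b ≠ 0 there is no sequence of smooth strong
roots (u_j, p_j) of (u·∇)u + μ_j ∂₁u + ∇p = f_K (f_K = stokesMode ![0,2,0] e₀ false, the route's
force BY NAME), div u_j = 0, with purely vertical drifts μ_j → +∞ and ‖u_j − w̄_{a,b}‖_{H⁸(T³)} → 0
(eSobolevNorm 8 of the complexified difference), w̄_{a,b} = a∇⊥ψ̄ + bψ̄e₁, ψ̄ = sin2πx₀ sin2πx₂
(four first-shell stokesModes). Implied by RootsPlanar (a smooth strong root minus its mean is a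
cylindrical weak root with drift ⟨u⟩ + μe₁; the planarity defect is L²-continuous and
defect(w̄_{a,b}) ≥ the energy of one first-shell pair > 0); does NOT imply R_∞ or F. Mechanism
(lens-4 g20 TLD-v2 §3 R2, certified census TLD-v2-CERT + crit tld2chk, four exact codes): the
x₁-averaged horizontal-vorticity identity (ū_h·∇)ω̄ + curl_h div_h⟨u′_h⊗u′_h⟩ = 0 holds EXACTLY for
every smooth root, so the eddy datum vanishes at every stagna -/
@[route_item "route-AnomalousDissipation-SteadyCoherentFraction"]
def LargeDriftCellExclusion : Prop :=
  ∀ (a b : ℝ), 0 < a → b ≠ 0 → ∀ (μ : ℕ → ℝ) (u : ℕ → UnitAddTorus (Fin 3) → EuclideanSpace ℝ (Fin 3)), Filter.Tendsto μ Filter.atTop Filter.atTop → (∀ j, (Literature.Analysis.FunctionSpaces.Torus.IsSmooth (u j) ∧ Literature.Analysis.FunctionSpaces.Torus.IsDivFree (u j) ∧ ∃ p : UnitAddTorus (Fin 3) → ℝ, Literature.Analysis.FunctionSpaces.Torus.IsSmooth p ∧ ∀ x, Literature.Analysis.FunctionSpaces.Torus.convect (u j) (u j) x + μ j • Literature.Analysis.FunctionSpaces.Torus.partialDeriv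 (1 : Fin 3) (u j) x + Literature.Analysis.FunctionSpaces.Torus.gradient p x = Literature.Analysis.FluidPDE.Torus.stokesMode (![0, 2, 0] : Fin 3 → ℤ) (EuclideanSpace.single (0 : Fin 3) (1 : ℝ)) false x)) → ¬ Filter.Tendsto (fun j => Literature.Analysis.FunctionSpaces.Torus.eSobolevNorm (8 : ℝ) (Literature.Analysis.FunctionSpaces.EuclideanSpace.complexify ∘ (fun x => u j x - (Literature.Analysis.FluidPDE.Torus.stokesMode (![1, 0, 1] : Fin 3 → ℤ) ((a / 2) • (EuclideanSpace.single (0 : Fin 3) (1 : ℝ) - EuclideanSpace.single (2 : Fin 3) (1 : ℝ))) false x + Literature.Analysis.FluidPDE.Torus.stokesMode (![1, 0, -1] : Fin 3 → ℤ) ((a / 2) • (EuclideanSpace.single (0 : Fin 3) (1 : ℝ) + EuclideanSpace.single (2 : Fin 3) (1 : ℝ))) false x + Literature.Analysis.FluidPDE.Torus.stokesMode (![1, 0, -1] : Fin 3 → ℤ) ((b / 2) • EuclideanSpace.single (1 : Fin 3) (1 : ℝ)) true x - Literature.Analysis.FluidPDE.Torus.stokesMode (![1, 0, 1] : Fin 3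 → ℤ) ((b / 2) • EuclideanSpace.single (1 : Fin 3) (1 : ℝ)) true x)))) Filter.atTop (nhds 0)

/-- item stmt-AnomalousDissipation-28525 · support · rank 9 · closed · moot by None · by planner
sources: arXiv:2601.08647, doi:10.1017/CBO9780511546754
[support] (THEOREM-GRADE TARGET (cell card §5) · FIRST PROVER TARGET · not proved; replaces the
parent supports TameClimateReduction / InvariantHullReduction / FiniteModeClimatesPlanar in this
cone) RootsPlanar implies the tame half of the steady door at every enstrophy level R: for every φ,
M there is θ₀ > 0 such that steady Leray–Hopf states with ‖∇u₀‖² ≤ R, energy ≤ M, dissipation ≤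
θ₀·energy have defect ≤ φ·energy. Proof sketch (contrapositive): a violating sequence has ν_n‖∇u_n‖²
≤ E_n/n; energies cannot vanish (test the steady weak form against a fixed trigonometric Ψ with
⟨f_K,Ψ⟩ = 1); ν_n → 0 (else ‖∇u_n‖ → 0 contradicts f_K ≠ 0); the viscous term is ≤
(ν_n·ν_n‖∇u_n‖²)^{1/2}‖∇Ψ‖ → 0; Rellich gives a strong L² limit m + v with ‖∇v‖² ≤ R which is a
root; the defect is an infimum of L²-continuous functionals hence upper semicontinuous, so defect(v)
≥ limsup defect(u_n) ≥ φ·lim E_n > 0 — a non-planar finite-enstrophy root. [difficulty: M] -/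
@[route_item "route-AnomalousDissipation-SteadyCoherentFraction"]
def SteadyTameReduction : Prop :=
  (∀ (m : EuclideanSpace ℝ (Fin 3)) (R : ℝ) (v : ↥(Literature.Analysis.FunctionSpaces.Torus.energySpace (Fin 3))), Literature.Analysis.FunctionSpaces.Torus.eGradNormSq ((v : MeasureTheory.Lp (EuclideanSpace ℝ (Fin 3)) 2 (MeasureTheory.volume : MeasureTheory.Measure (UnitAddTorus (Fin 3)))) : UnitAddTorus (Fin 3) → EuclideanSpace ℝ (Fin 3)) ≤ ENNReal.ofReal R → (∀ Φ : Literature.Analysis.FluidPDE.Torus.CylindricalTest (Fin 3), ((∫ x, ⟪⇑(Literature.Analysis.FluidPDE.Torus.stokesMode (![0, 2, 0] : Fin 3 → ℤ) (EuclideanSpace.single (0 : Fin 3) (1 : ℝ)) false) x, Φ.grad v x⟫_ℝ) + (∫ x, ⟪((v : MeasureTheory.Lp (EuclideanSpace ℝ (Fin 3)) 2 (MeasureTheory.volume : MeasureTheory.Measure (UnitAddTorus (Fin 3)))) : UnitAddTorus (Fin 3) → EuclideanSpace ℝ (Fin 3)) x, Literature.Analysis.FunctionSpaces.Torus.fderiv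 (Φ.grad v) x m⟫_ℝ) + Literature.Analysis.FluidPDE.Torus.inertialPairing (v : MeasureTheory.Lp (EuclideanSpace ℝ (Fin 3)) 2 (MeasureTheory.volume : MeasureTheory.Measure (UnitAddTorus (Fin 3)))) (Φ.grad v)) = 0) → (⨅ p : {p : ℤ × ℤ // p ≠ 0}, (1 / 2 : ℝ) * ∫ s in (0 : ℝ)..1, ∫ x, ‖((v : MeasureTheory.Lp (EuclideanSpace ℝ (Fin 3)) 2 (MeasureTheory.volume : MeasureTheory.Measure (UnitAddTorus (Fin 3)))) : UnitAddTorus (Fin 3) → EuclideanSpace ℝ (Fin 3)) (x + Literature.Analysis.FluidPDE.toTorus (fun i => s * (![((p.1.1 : ℤ) : ℝ), 0, ((p.1.2 : ℤ) : ℝ)] : Fin 3 → ℝ) i)) - ((v : MeasureTheory.Lp (EuclideanSpace ℝ (Fin 3)) 2 (MeasureTheory.volume : MeasureTheory.Measure (UnitAddTorus (Fin 3)))) : UnitAddTorus (Fin 3) → EuclideanSpace ℝ (Fin 3)) x‖ ^ 2) = 0) → (∀ R : ℝ, ∀ φ : ℝ, 0 < φ → ∀ M : ℝ, 0 < M → ∃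 θ₀ : ℝ, 0 < θ₀ ∧ ∀ ν : ℝ, 0 < ν → ν ≤ 1 → ∀ (u₀ : UnitAddTorus (Fin 3) → EuclideanSpace ℝ (Fin 3)), Literature.Analysis.FluidPDE.Torus.IsGlobalLerayHopf ν (fun _ => ⇑(Literature.Analysis.FluidPDE.Torus.stokesMode (![0, 2, 0] : Fin 3 → ℤ) (EuclideanSpace.single (0 : Fin 3) (1 : ℝ)) false)) u₀ (fun _ => u₀) → Literature.Analysis.FunctionSpaces.Torus.eGradNormSq u₀ ≤ ENNReal.ofReal R → Literature.Analysis.FluidPDE.meanEnergy (fun _ => u₀) ≤ M → Literature.Analysis.FluidPDE.meanDissipation ν (fun _ => u₀) ≤ θ₀ * Literature.Analysis.FluidPDE.meanEnergy (fun _ => u₀) → Literature.Analysis.FluidPDE.longTimeAvgSup (fun _ => ⨅ p : {p : ℤ × ℤ // p ≠ 0}, (1 / 2 : ℝ) * ∫ s in (0 : ℝ)..1, ∫ x, ‖u₀ (x + Literature.Analysis.FluidPDE.toTorus (fun i => s * (![((p.1.1 : ℤ) : ℝ), 0, ((p.1.2 : ℤ) : ℝ)] : Fin 3 → ℝ) i))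 - u₀ x‖ ^ 2) ≤ φ * Literature.Analysis.FluidPDE.meanEnergy (fun _ => u₀))

/-- item stmt-AnomalousDissipation-28526 · aside · rank 9 · closed · moot by None · by planner
sources: AlexakisDoering2006, doi:10.1017/jfm.2012.524
[support] (ASIDE — the trimmed door in one piece, never staffed; kind aside in route.json) the
parent door BoundedQuietPlanarity restricted to steady Leray–Hopf states: for every φ, M there is θ₀
> 0 such that every steady global Leray–Hopf state of NS_ν(f_K), 0 < ν ≤ 1, with energy ≤ M and
dissipation ≤ θ₀·energy has defect ≤ φ·energy. Kernel: weaker than BoundedQuietPlanarity; exact cut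
SteadyQuietPlanarity ⟺ TameSteadyQuietPlanarity ∧ RoughSteadyQuietPlanarity. [difficulty:
open-problem] -/
@[route_item "route-AnomalousDissipation-SteadyCoherentFraction"]
def SteadyQuietPlanarity : Prop :=
  ∀ φ : ℝ, 0 < φ → ∀ M : ℝ, 0 < M → ∃ θ₀ : ℝ, 0 < θ₀ ∧ ∀ ν : ℝ, 0 < ν → ν ≤ 1 → ∀ (u₀ : UnitAddTorus (Fin 3) → EuclideanSpace ℝ (Fin 3)), Literature.Analysis.FluidPDE.Torus.IsGlobalLerayHopf ν (fun _ => ⇑(Literature.Analysis.FluidPDE.Torus.stokesMode (![0, 2, 0] : Fin 3 → ℤ) (EuclideanSpace.single (0 : Fin 3) (1 : ℝ)) false)) u₀ (fun _ => u₀) → Literature.Analysis.FluidPDE.meanEnergy (fun _ => u₀) ≤ M → Literature.Analysis.FluidPDE.meanDissipation ν (fun _ => u₀) ≤ θ₀ * Literature.Analysis.FluidPDE.meanEnergy (fun _ => u₀) → Literature.Analysis.FluidPDE.longTimeAvgSup (fun _ => ⨅ p : {p : ℤ × ℤ // p ≠ 0}, (1 / 2 : ℝ) * ∫ s in (0 :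 ℝ)..1, ∫ x, ‖u₀ (x + Literature.Analysis.FluidPDE.toTorus (fun i => s * (![((p.1.1 : ℤ) : ℝ), 0, ((p.1.2 : ℤ) : ℝ)] : Fin 3 → ℝ) i)) - u₀ x‖ ^ 2) ≤ φ * Literature.Analysis.FluidPDE.meanEnergy (fun _ => u₀)

/-- item stmt-AnomalousDissipation-28527 · aside · rank 9 · closed · moot by None · by planner
sources: AlexakisDoering2006, arXiv:2601.08647
[support] (ASIDE — exactness witness of the tame/rough cut, never staffed; kind aside in route.json)
the tame half of the steady door at every enstrophy level R (the parent aside TameQuietPlanarity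
restricted to steady states; kernel-weaker). [difficulty: open-problem] -/
@[route_item "route-AnomalousDissipation-SteadyCoherentFraction"]
def TameSteadyQuietPlanarity : Prop :=
  ∀ R : ℝ, ∀ φ : ℝ, 0 < φ → ∀ M : ℝ, 0 < M → ∃ θ₀ : ℝ, 0 < θ₀ ∧ ∀ ν : ℝ, 0 < ν → ν ≤ 1 → ∀ (u₀ : UnitAddTorus (Fin 3) → EuclideanSpace ℝ (Fin 3)), Literature.Analysis.FluidPDE.Torus.IsGlobalLerayHopf ν (fun _ => ⇑(Literature.Analysis.FluidPDE.Torus.stokesMode (![0, 2, 0] : Fin 3 → ℤ) (EuclideanSpace.single (0 : Fin 3) (1 : ℝ)) false)) u₀ (fun _ => u₀) → Literature.Analysis.FunctionSpaces.Torus.eGradNormSq u₀ ≤ ENNReal.ofReal R → Literature.Analysis.FluidPDE.meanEnergy (fun _ => u₀) ≤ M → Literature.Analysis.FluidPDE.meanDissipation ν (fun _ => u₀) ≤ θ₀ * Literature.Analysis.FluidPDE.meanEnergy (fun _ => u₀) → Literature.Analysis.FluidPDE.longTimeAvgSup (fun _ => ⨅ p : {p : ℤ × ℤ // p ≠ 0},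 (1 / 2 : ℝ) * ∫ s in (0 : ℝ)..1, ∫ x, ‖u₀ (x + Literature.Analysis.FluidPDE.toTorus (fun i => s * (![((p.1.1 : ℤ) : ℝ), 0, ((p.1.2 : ℤ) : ℝ)] : Fin 3 → ℝ) i)) - u₀ x‖ ^ 2) ≤ φ * Literature.Analysis.FluidPDE.meanEnergy (fun _ => u₀)

/-- item stmt-AnomalousDissipation-28528 · aside · rank 9 · closed · moot by None · by planner
sources: doi:10.1146/annurev-fluid-120710-101228, doi:10.1088/0169-5983/48/6/061425
[support] (ASIDE — typed mechanism statement, the conclusion of SteadyCoherentFractionPersists;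
never staffed; kind aside in route.json) there are E₀, φ₀ > 0, viscosities ν_j → 0 in (0,1] and
steady global Leray–Hopf states of NS_ν_j(f_K) with energy ≤ E₀, positive defect and defect ≥
φ₀·energy. Kernel: implies the parent aside BoundedThreeDCoherentStates. [difficulty: open-problem] -/
@[route_item "route-AnomalousDissipation-SteadyCoherentFraction"]
def BoundedThreeDSteadyStates : Prop :=
  ∃ (E₀ φ₀ : ℝ), 0 < E₀ ∧ 0 < φ₀ ∧ ∃ (ν : ℕ → ℝ), (∀ j, 0 < ν j) ∧ (∀ j, ν j ≤ 1) ∧ Filter.Tendsto ν Filter.atTop (nhds 0) ∧ ∀ j, ∃ (u₀ : UnitAddTorus (Fin 3) → EuclideanSpace ℝ (Fin 3)), Literature.Analysis.FluidPDE.Torus.IsGlobalLerayHopf (ν j) (fun _ => ⇑(Literature.Analysis.FluidPDE.Torus.stokesMode (![0, 2, 0] : Fin 3 → ℤ) (EuclideanSpace.single (0 : Fin 3) (1 : ℝ)) false)) u₀ (fun _ => u₀) ∧ Literature.Analysis.FluidPDE.meanEnergy (fun _ => u₀) ≤ E₀ ∧ 0 < Literature.Analysis.FluidPDE.longTimeAvgSup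 (fun _ => ⨅ p : {p : ℤ × ℤ // p ≠ 0}, (1 / 2 : ℝ) * ∫ s in (0 : ℝ)..1, ∫ x, ‖u₀ (x + Literature.Analysis.FluidPDE.toTorus (fun i => s * (![((p.1.1 : ℤ) : ℝ), 0, ((p.1.2 : ℤ) : ℝ)] : Fin 3 → ℝ) i)) - u₀ x‖ ^ 2) ∧ φ₀ * Literature.Analysis.FluidPDE.meanEnergy (fun _ => u₀) ≤ Literature.Analysis.FluidPDE.longTimeAvgSup (fun _ => ⨅ p : {p : ℤ × ℤ // p ≠ 0}, (1 / 2 : ℝ) * ∫ s in (0 : ℝ)..1, ∫ x, ‖u₀ (x + Literature.Analysis.FluidPDE.toTorus (fun i => s * (![((p.1.1 : ℤ) : ℝ), 0, ((p.1.2 : ℤ) : ℝ)] : Fin 3 → ℝ) i)) - u₀ x‖ ^ 2)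

/-- item stmt-AnomalousDissipation-28529 · assembly · rank 1 · closed · moot by None · by planner
sources: DoeringFoias2002, arXiv:2601.08647
[assembly] RatioUpgrade → RootsPlanar → SteadyTameReduction → RoughSteadyQuietPlanarity →
BoundedNonPlanarSteadyStates → SteadyCoherentFractionPersists → the zeroth law (literally theorem
closes). -/
@[route_item "route-AnomalousDissipation-SteadyCoherentFraction"]
def Assembly : Prop :=
  RatioUpgrade → RootsPlanar → SteadyTameReduction → RoughSteadyQuietPlanarity → BoundedNonPlanarSteadyStates → SteadyCoherentFractionPersists → _root_.AnomalousDissipation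

/-! D-0027 §2.1 — DECIDING THEOREM (planner-authored via `route open/edit --closes-file`; by planner-decomp-ad-lens-4-g19-0 2026-08-30T21:20:25Z) — ARCHIVED: route closed (refuted) 2026-09-03T00:54:44Z; kept so importers keep building:
its hypotheses are this route's items and its conclusion the sub-problem Statement (glue_lint), and it elaborates with this file. -/

@[closes "route-AnomalousDissipation-SteadyCoherentFraction"] theorem closes (hA : RatioUpgrade) (hP : RootsPlanar) (hT : SteadyTameReduction)
    (hK : RoughSteadyQuietPlanarity) (hC : BoundedNonPlanarSteadyStates) (hU : SteadyCoherentFractionPersists) :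
    _root_.AnomalousDissipation := by
  obtain ⟨E₀, φ₀, hE₀, hφ₀, ν, hν, hν1, hν0, hfam⟩ := hU hC
  obtain ⟨R, hR⟩ := hK
  obtain ⟨θ₁, hθ₁, h₁⟩ := hT hP R (φ₀ / 2) (by positivity) E₀ hE₀
  obtain ⟨θ₂, hθ₂, h₂⟩ := hR (φ₀ / 2) (by positivity) E₀ hE₀
  apply hA
  have hk : ((![0, 2, 0] : Fin 3 → ℤ)) ≠ 0 := by
    intro h
    have := congrFun h 1
    simp at this
  have hka : inner ℝ (Literature.Analysis.FunctionSpaces.Torus.latticeVec ((![0, 2, 0] : Fin 3 → ℤ)))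
      (EuclideanSpace.single (0 : Fin 3) (1 : ℝ)) = 0 := by
    rw [EuclideanSpace.inner_single_right]
    simp [Literature.Analysis.FunctionSpaces.Torus.latticeVec_apply]
  have key : ∀ j, ∃ (u₀ : UnitAddTorus (Fin 3) → EuclideanSpace ℝ (Fin 3)),
      Literature.Analysis.FluidPDE.Torus.IsGlobalLerayHopf (ν j)
          (fun _ => ⇑(Literature.Analysis.FluidPDE.Torus.stokesMode ((![0, 2, 0] : Fin 3 → ℤ))
            (EuclideanSpace.single (0 : Fin 3) (1 : ℝ)) false)) u₀ (fun _ => u₀) ∧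
        min θ₁ θ₂ * Literature.Analysis.FluidPDE.meanEnergy (fun _ : ℝ => u₀) <
          Literature.Analysis.FluidPDE.meanDissipation (ν j) (fun _ : ℝ => u₀) := by
    intro j
    obtain ⟨u₀, hLH, hE, hpos, hfrac⟩ := hfam j
    refine ⟨u₀, hLH, ?_⟩
    by_contra hq
    rw [not_lt] at hq
    have hE0 : 0 ≤ Literature.Analysis.FluidPDE.meanEnergy (fun _ : ℝ => u₀) :=
      Literature.Analysis.FluidPDE.meanEnergy_nonneg _
    have hsmall : Literature.Analysis.FluidPDE.longTimeAvgSup (fun _ => ⨅ p : {p : ℤ × ℤ // p ≠ 0}, (1 / 2 : ℝ) *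
        ∫ s in (0 : ℝ)..1, ∫ x, ‖u₀ (x + Literature.Analysis.FluidPDE.toTorus
          (fun i => s * (![((p.1.1 : ℤ) : ℝ), 0, ((p.1.2 : ℤ) : ℝ)] : Fin 3 → ℝ) i)) - u₀ x‖ ^ 2) ≤
        φ₀ / 2 * Literature.Analysis.FluidPDE.meanEnergy (fun _ : ℝ => u₀) := by
      rcases le_or_gt (Literature.Analysis.FunctionSpaces.Torus.eGradNormSq u₀) (ENNReal.ofReal R) with hZ | hZ
      · exact h₁ (ν j) (hν j) (hν1 j) u₀ hLH hZ hE
          (hq.trans (mul_le_mul_of_nonneg_right (min_le_left _ _) hE0))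
      · exact h₂ (ν j) (hν j) (hν1 j) u₀ hLH hZ hE
          (hq.trans (mul_le_mul_of_nonneg_right (min_le_right _ _) hE0))
    have hEle : Literature.Analysis.FluidPDE.meanEnergy (fun _ : ℝ => u₀) ≤ 0 := by
      by_contra hc
      have := mul_pos (half_pos hφ₀) (not_le.mp hc)
      linarith
    exact absurd hpos (not_lt.mpr (hsmall.trans (mul_nonpos_iff.mpr (Or.inl ⟨(half_pos hφ₀).le, hEle⟩))))
  choose u₀ hu using key
  exact ⟨⇑(Literature.Analysis.FluidPDE.Torus.stokesMode ((![0, 2, 0] : Fin 3 → ℤ))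
      (EuclideanSpace.single (0 : Fin 3) (1 : ℝ)) false),
    Literature.Analysis.FluidPDE.Torus.isSmooth_stokesMode _ _ _,
    Literature.Analysis.FluidPDE.Torus.isDivFree_stokesMode hka false,
    Literature.Analysis.FluidPDE.Torus.hasZeroMean_stokesMode hk _ _,
    min θ₁ θ₂, lt_min hθ₁ hθ₂, ν, u₀, fun j _ => u₀ j, hν, hν0, fun j => (hu j).1, fun j => (hu j).2⟩

end Summit.AnomalousDissipation.AnomalousDissipation.Theses.SteadyCoherentFraction
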